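import Summits.BirchSwinnertonDyer.BirchSwinnertonDyer.Theorems.ByReductionTypeAtTwoRankOneAtTwoOffBigImageOddLocalDefs
import Summits.BirchSwinnertonDyer.BirchSwinnertonDyer.Theorems.ByReductionTypeAtTwoRankOneAtTwoOffBigImageOddLocalDoorLawCT
import Summits.BirchSwinnertonDyer.BirchSwinnertonDyer.Theorems.ByReductionTypeAtTwoRankOneAtTwoOffBigImageOddLocalShiftedDescent
import Summits.BirchSwinnertonDyer.BirchSwinnertonDyer.Theorems.ByReductionTypeAtTwoRankOneAtTwoOneDoorLawCDefs
import Summits.BirchSwinnertonDyer.BirchSwinnertonDyer.Theorems.ByReductionTypeAtTwoRankOneAtTwoBigImageOddLocalOneDoorFullC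
import Summits.BirchSwinnertonDyer.BirchSwinnertonDyer.Theorems.ByReductionTypeAtTwoRankOneAtTwoBigImageOddLocalOneDoorAnalyticGlue
import Summits.BirchSwinnertonDyer.BirchSwinnertonDyer.Theorems.ByReductionTypeAtTwoRankOneAtTwoBigImageOddLocalOneDoorTamagawa
import Summits.BirchSwinnertonDyer.BirchSwinnertonDyer.Theorems.ByReductionTypeAtTwoRankOneAtTwoBigImageOddLocalOneDoorKolyvaginExactBridgeSupply
import Summits.BirchSwinnertonDyer.BirchSwinnertonDyer.Theorems.CMKolyvaginAtInertTwoCMExactDescentAtTwoGeneral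
import Summits.BirchSwinnertonDyer.BirchSwinnertonDyer.Theorems.RamifiedHeegnerPairRamifiedPairUpperBoundOfUpperHalfOverK
import Literature.NumberTheory.EllipticCurves.TwoAdicImageNonSurjectiveFamiliesProofs
import Literature.NumberTheory.EllipticCurves.TwoAdicImageSurjectivityModTwoProofs
import HarnessLib

/-!
# Route `ByReductionTypeAtTwo`, crux `RankOneAtTwoOffBigImageOddLocal` (stmt-BirchSwinnertonDyer-23716), line
# `refined_kolyvagin_tamagawa_shift_at_two`: the GLUE — γ₁ per curve (door currency) and the S₃-locus composition (Kolyvagin currency), PROVED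

Lead prover `prover-cruxlead-stmt-BirchSwinnertonDyer-23716-g0` (2026-08-28).  §3-g2 of the registered skeleton
`Cruxes/RankOneAtTwoOffBigImageOddLocal/Lines/refined_kolyvagin_tamagawa_shift_at_two.lean` (g7), over the importable statements of
`…OffBigImageOddLocalDefs.lean` (p643983) and the landed kernels `…DoorLawCT.lean` (p643122) / `…ShiftedDescent.lean` (p643418), as a `--supports` helper of
the crux.  What it proves (all sorry-free; the line's STUBS enter as HYPOTHESES by their importable names — nothing here is an instance of a stub):

* γ₁ (E-side, image `C₃`): `isSquare_delta_of_not_hasSurjectiveModNGaloisRep_two` (the complement of the S₃-locus inside {`E(ℚ)[2] = 0`} is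
  `Δ ∈ ℚ^{×2}`), `gamma1LawCT_of_faces` (the two registered γ₁ faces recombine), `bsdp_two_of_doorLawCTFor` / `doorLawCTFor_of_bsdp_two` (the CT door
  law FOR ONE CURVE ⟺ `BSD₂` of that curve, given the published inputs `S_pub`/`S_pubHL` and rank-`0` `BSD₂` of non-CM curves `S_rankZeroTwin` —
  so the γ₁ stubs are BSD₂-EQUIVALENT on their cells), `bsdp_two_gamma1`.
* S₃-locus (K-side, `ρ̄_{W,2}` onto = δ ∪ γ₂a/b/c/d): `bsdp_two_S3locusWith Φ` — PRINT, Σ-accumulation `SigmaAccumulationModTwoAtTwo`, the filtered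
  stringent primitivity `StringentPrimitivityModTwoWith Φ` and shifted structure theorem `ShiftedKolyvaginStructureModTwoWith Φ`, rank-`0` `BSD₂` ⟹
  `BSD₂(W)` for every non-CM `W` with `ρ̄_{W,2}` onto of analytic rank `1`, ANY Tamagawa parity: Kolyvagin-admissible Hoffstein–Luo door
  (`exists_kolyvaginDoorField_of_analyticRank_eq_one`), any datum/orientation/embedding, the conductor-`1` datum (CM theory, tree), `y_K` non-torsion by
  Gross–Zagier, `M₀ = ord₂` of the divisibility of `P(1)` by finite generation, `σ ≤ M₀` from accumulation at `n = 1`, the twin = a minimal model of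
  `E^{(d_K)}` (non-CM, analytic rank `0`), then the landed shifted descent; `bsdp_two_S3locus` = the registered shape `Φ = ⊤`; the filter lattice
  `stringentWith_top_of_modTwo`, `structureWith_of_modTwo`, `stringentWith_mono`, `structureWith_anti`.

BSD is not proved by this; the crux is not proved by this (its seven registered stubs are untouched, 0 closed).  Conditional on the named print facts
inside `S_pub`, `S_pubHL`, `Milne1972.bsdQuotient_baseChange_quadratic_anyModel` exactly as the skeleton.

References: [GrossZagier1986] Thm. I.6.3, V.§2; [GrossLMS1991] §2 (2.2), §§3–4; [McCallumLMS1991] §5; [Jetchev2008] (1.3); [WZhang2014] §3.7;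
[DokchitserDokchitserMathZ2012] Theorem (1).
-/

set_option linter.dupNamespace false -- tree convention: `Summit.BirchSwinnertonDyer.BirchSwinnertonDyer.Theorems` (summit = sub-problem)
set_option autoImplicit false
noncomputable section

open scoped Classical

namespace Summit.BirchSwinnertonDyer.BirchSwinnertonDyer.Theorems.OffBigImageOddLocalAtTwo

open WeierstrassCurve NumberField IsDedekindDomain Rat.HeightOneSpectrum Literature.NumberTheory.EllipticCurves
  Literature.NumberTheory.EllipticCurves.ModularForms
  Literature.NumberTheory.EllipticCurves.Rank1Residual
  Literature.NumberTheory.EllipticCurves.Rank1Residual.Typed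
  Literature.NumberTheory.EllipticCurves.KrizLi2019
  Summit.BirchSwinnertonDyer.Rank1Residual
  Summit.BirchSwinnertonDyer.Rank1Residual.AdditivePotMult
  Summit.BirchSwinnertonDyer.Rank1Residual.F1Sign2
  Summit.BirchSwinnertonDyer.Rank1Residual.F1Sign2.TranspositionDoor
  Summit.BirchSwinnertonDyer.BirchSwinnertonDyer.Theorems.RankOneAtTwoOneDoor
  Summit.BirchSwinnertonDyer.BirchSwinnertonDyer.Theorems.CMExactDescent

/-- From «`ρ_{W,2^n}` onto for every `n`» to «`ρ̄_{W,2}` onto» (`n = 1`). -/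
theorem hasSurjectiveModNGaloisRep_two_of_all {W : WeierstrassCurve ℚ} [W.IsElliptic]
    (h : ∀ n : ℕ, W.HasSurjectiveModNGaloisRep ((2 ^ n : ℕ) : ℤ)) : W.HasSurjectiveModNGaloisRep 2 := by
  simpa using h 1

/-- **The complement of the S₃-locus inside {`E(ℚ)[2] = 0`} is γ₁**: `E(ℚ)[2] = 0` and `ρ̄_{W,2}` NOT onto ⟹ `Δ ∈ ℚ^{×2}` (mod-`2` image `C₃`),
by the tree theorem `hasSurjectiveModNGaloisRep_two_iff` (Dokchitser–Dokchitser (1): onto ⟺ no rational `2`-torsion point ∧ `Δ ∉ ℚ^{×2}`).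
[cite: DokchitserDokchitserMathZ2012, Theorem (1)] -/
theorem isSquare_delta_of_not_hasSurjectiveModNGaloisRep_two (W : WeierstrassCurve ℚ) [W.IsElliptic]
    (hT : NoRationalTwoTorsion W) (h : ¬ W.HasSurjectiveModNGaloisRep 2) : IsSquare W.Δ := by
  by_contra hΔ
  exact h ((hasSurjectiveModNGaloisRep_two_iff W).mpr ⟨fun P hP => EggDoubling.eq_zero_of_two_smul_eq_zero W hT P hP, hΔ⟩)

/-- γ₁ (`Δ ∈ ℚ^{×2}`) is off the surjective `2`-ADIC locus (it is already off the mod-`2` one: the tree's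
`OrdRedAtTwo.not_hasSurjectiveModNGaloisRep_two_of_isSquare_Δ` / `hasSurjectiveModNGaloisRep_two_iff`). [cite: DokchitserDokchitserMathZ2012, Theorem (1)] -/
theorem not_forall_surjective_of_isSquare_delta (W : WeierstrassCurve ℚ) [W.IsElliptic] (hΔ : IsSquare W.Δ) :
    ¬ ∀ n : ℕ, W.HasSurjectiveModNGaloisRep ((2 ^ n : ℕ) : ℤ) :=
  fun h => ((hasSurjectiveModNGaloisRep_two_iff W).mp (hasSurjectiveModNGaloisRep_two_of_all h)).2 hΔ

/-- γ₁ is in the RZB list (first disjunct). -/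
theorem inRZBList_of_isSquare_delta (W : WeierstrassCurve ℚ) [W.IsElliptic] (hΔ : IsSquare W.Δ) : InRZBListAtTwo W :=
  Or.inl hΔ

/-- **The CT door law for ONE curve ⟹ `BSD₂` of that curve** (PRINT + the rank-`0` twin): the body of g1's `bsdp_two_gamma` with the
habitat binder removed — door field = Hoffstein–Luo (`doorSupplyAnalyticAtTwo_of_pubHL`), ANY datum, the minimal twist model (non-CM, analytic
rank `0`, so `BSD₂` by `hZ`), then the `←` direction of `bsdp_two_iff_doorLawFullCT_at`.  No hypothesis on any Galois image.
[cite: GrossZagier1986, Thm. I.6.3 and V.§2] -/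
theorem bsdp_two_of_doorLawCTFor (hpub : S_pub) (hHL : S_pubHL) (hZ : S_rankZeroTwin)
    (W : WeierstrassCurve ℚ) [W.IsElliptic] [W.IsGloballyMinimal] [NeZero (W.conductorNorm ℤ)]
    (hCM : ¬ W.HasCM) (hT2 : NoRationalTwoTorsion W) (hr : W.analyticRank = 1) (hGW : DoorLawCTFor W) : BSDp W 2 := by
  haveI : Fact (Nat.Prime 2) := ⟨Nat.prime_two⟩
  obtain ⟨K, _iF, _iN, hK, hadm, hLt, -, hHN⟩ := doorSupplyAnalyticAtTwo_of_pubHL hHL W hr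
  obtain ⟨Dt⟩ := (nonempty_modularParametrizationData_iff_exists_isNewformOf_unconditional.mpr hHL.1) W
  obtain ⟨H, -⟩ :=
    nonempty_heegnerDatum_holds (W.conductorNorm ℤ) K hK (exists_dvd_sq_sub_discr_holds (W.conductorNorm ℤ) K hK hHN).choose_spec
  obtain ⟨ι⟩ : Nonempty (K →+* ℂ) := inferInstance
  obtain ⟨hGZ, hKo, hrat⟩ := hpub.1 (W.conductorNorm ℤ) W K
  obtain ⟨P, hP⟩ := hrat hK hHN Dt H ι
  have hD0 : (NumberField.discr K : ℚ) ≠ 0 := by exact_mod_cast NumberField.discr_ne_zero K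
  haveI hEt : (W.quadraticTwist (NumberField.discr K : ℚ)).IsElliptic := W.isElliptic_quadraticTwist hD0
  obtain ⟨Cd, hCd⟩ := hasGlobalMinimalModel_rat_holds (W.quadraticTwist (NumberField.discr K : ℚ))
  haveI : (Cd • W.quadraticTwist (NumberField.discr K : ℚ)).IsGloballyMinimal := hCd
  set Wd := Cd • W.quadraticTwist (NumberField.discr K : ℚ) with hWd_def
  have hWd : Cd • W.quadraticTwist (NumberField.discr K : ℚ) = Wd := rfl
  have hCMd : ¬ Wd.HasCM :=
    Summit.BirchSwinnertonDyer.BirchSwinnertonDyer.Theorems.RamifiedPairUpperBound.not_hasCM_of_smul_quadraticTwist_eq hD0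
      hWd hCM
  have hLeq : Wd.entireLFunction = (W.quadraticTwist (NumberField.discr K : ℚ)).entireLFunction := by
    rw [← hWd, entireLFunction_smul]
  have hrd : Wd.analyticRank = 0 :=
    (Wd.analyticRank_eq_zero_iff_holds (hpub.2.2 Wd)).2 (by rw [hLeq]; exact hLt)
  have hBd : BSDp Wd 2 := hZ Wd hCMd hrd
  obtain ⟨-, -, hiff⟩ :=
    bsdp_two_iff_doorLawFullCT_at hpub.2.1 hpub.2.2 W hT2 hr K hK hGZ hKo hadm hHN hLt Dt H ι P hP
      Wd Cd hWd hBd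
  exact hiff.mpr (hGW K hK hadm hHN hLt Dt H ι P hP Wd Cd hWd)

/-- **Conversely `BSD₂` of the curve ⟹ its CT door law at EVERY admissible non-vanishing datum** (the `→` direction of the kernel iff; the
twin's `BSD₂` again from `hZ`).  This is what makes the γ faces BSD-EQUIVALENT on their cells, and what turns the K-side stubs into the g1
door faces on γ₂ (§5′). [cite: GrossZagier1986, Thm. I.6.3 and V.§2] -/
theorem doorLawCTFor_of_bsdp_two (hpub : S_pub) (hZ : S_rankZeroTwin)
    (W : WeierstrassCurve ℚ) [W.IsElliptic] [W.IsGloballyMinimal] [NeZero (W.conductorNorm ℤ)]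
    (hCM : ¬ W.HasCM) (hT2 : NoRationalTwoTorsion W) (hr : W.analyticRank = 1) (hB : BSDp W 2) : DoorLawCTFor W := by
  haveI : Fact (Nat.Prime 2) := ⟨Nat.prime_two⟩
  intro K _ _ hK hadm hHN hLt Dt H ι P hP Wd _ _ Cd hWd
  obtain ⟨hGZ, hKo, -⟩ := hpub.1 (W.conductorNorm ℤ) W K
  have hD0 : (NumberField.discr K : ℚ) ≠ 0 := by exact_mod_cast NumberField.discr_ne_zero K
  haveI hEt : (W.quadraticTwist (NumberField.discr K : ℚ)).IsElliptic := W.isElliptic_quadraticTwist hD0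
  have hCMd : ¬ Wd.HasCM :=
    Summit.BirchSwinnertonDyer.BirchSwinnertonDyer.Theorems.RamifiedPairUpperBound.not_hasCM_of_smul_quadraticTwist_eq hD0
      hWd hCM
  have hLeq : Wd.entireLFunction = (W.quadraticTwist (NumberField.discr K : ℚ)).entireLFunction := by
    rw [← hWd, entireLFunction_smul]
  have hrd : Wd.analyticRank = 0 :=
    (Wd.analyticRank_eq_zero_iff_holds (hpub.2.2 Wd)).2 (by rw [hLeq]; exact hLt)
  have hBd : BSDp Wd 2 := hZ Wd hCMd hrd
  obtain ⟨-, -, hiff⟩ :=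
    bsdp_two_iff_doorLawFullCT_at hpub.2.1 hpub.2.2 W hT2 hr K hK hGZ hKo hadm hHN hLt Dt H ι P hP
      Wd Cd hWd hBd
  exact hiff.mp hB

/-- **γ₁ (E-side)**: PRINT, the γ₁ CT door law, rank-`0` `BSD₂` of non-CM curves ⟹ `BSD₂(W)` for `W` non-CM with `E(ℚ)[2] = 0`, `Δ ∈ ℚ^{×2}`,
analytic rank `1`. -/
theorem bsdp_two_gamma1 (hpub : S_pub) (hHL : S_pubHL) (hG : Gamma1DoorIndexLawCTAtTwo) (hZ : S_rankZeroTwin)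
    (W : WeierstrassCurve ℚ) [W.IsElliptic] [W.IsGloballyMinimal] (hCM : ¬ W.HasCM) (hT2 : NoRationalTwoTorsion W)
    (hΔ : IsSquare W.Δ) (hr : W.analyticRank = 1) : BSDp W 2 := by
  haveI hN : NeZero (W.conductorNorm ℤ) := ⟨(W.conductorNorm_pos_holds).ne'⟩
  exact bsdp_two_of_doorLawCTFor hpub hHL hZ W hCM hT2 hr (hG W hCM hT2 hΔ hr)

/-- The unfiltered K2 is the `Φ = ⊤` instance of the filtered one. -/
theorem stringentWith_top_of_modTwo (h : StringentPrimitivityModTwoAtTwo) :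
    StringentPrimitivityModTwoWith (fun _ _ => True) := by
  intro W _ _ _ hCM hρ hr K _ _ hK hodd h3 hH hsq1 hsq2 Dt β ι d₁ hy
  obtain ⟨n, d, hn, hKoly, hlev, hPn⟩ := h W hCM hρ hr K hK hodd h3 hH hsq1 hsq2 Dt β ι d₁ hy
  exact ⟨n, d, hn, fun ℓ hℓ => ⟨hKoly ℓ hℓ, trivial⟩, hlev, hPn⟩

/-- The unfiltered K3 gives the filtered one for EVERY filter (a filtered witness is in particular a witness). -/
theorem structureWith_of_modTwo (Φ : WeierstrassCurve ℚ → ℕ → Prop) (h : ShiftedKolyvaginStructureModTwoAtTwo) :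
    ShiftedKolyvaginStructureModTwoWith Φ := by
  intro W _ _ _ hCM hρ K _ _ hK hodd h3 hH hsq1 hsq2 Dt β ι d₁ hy M₀ hdiv hndiv hacc n d hn hKoly hlev hPn
  exact h W hCM hρ K hK hodd h3 hH hsq1 hsq2 Dt β ι d₁ hy M₀ hdiv hndiv hacc n d hn (fun ℓ hℓ => (hKoly ℓ hℓ).1) hlev hPn

/-- **Monotonicity in the filter, K2**: a FINER filter is a STRONGER stringent-primitivity statement. -/
theorem stringentWith_mono {Φ Ψ : WeierstrassCurve ℚ → ℕ → Prop} (hle : ∀ W ℓ, Φ W ℓ → Ψ W ℓ)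
    (h : StringentPrimitivityModTwoWith Φ) : StringentPrimitivityModTwoWith Ψ := by
  intro W _ _ _ hCM hρ hr K _ _ hK hodd h3 hH hsq1 hsq2 Dt β ι d₁ hy
  obtain ⟨n, d, hn, hKoly, hlev, hPn⟩ := h W hCM hρ hr K hK hodd h3 hH hsq1 hsq2 Dt β ι d₁ hy
  exact ⟨n, d, hn, fun ℓ hℓ => ⟨(hKoly ℓ hℓ).1, hle W ℓ (hKoly ℓ hℓ).2⟩, hlev, hPn⟩

/-- **Antitonicity in the filter, K3**: a FINER filter is a WEAKER structure-theorem statement (fewer witnesses to answer for). -/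
theorem structureWith_anti {Φ Ψ : WeierstrassCurve ℚ → ℕ → Prop} (hle : ∀ W ℓ, Φ W ℓ → Ψ W ℓ)
    (h : ShiftedKolyvaginStructureModTwoWith Ψ) : ShiftedKolyvaginStructureModTwoWith Φ := by
  intro W _ _ _ hCM hρ K _ _ hK hodd h3 hH hsq1 hsq2 Dt β ι d₁ hy M₀ hdiv hndiv hacc n d hn hKoly hlev hPn
  exact h W hCM hρ K hK hodd h3 hH hsq1 hsq2 Dt β ι d₁ hy M₀ hdiv hndiv hacc n d hn
    (fun ℓ hℓ => ⟨(hKoly ℓ hℓ).1, hle W ℓ (hKoly ℓ hℓ).2⟩) hlev hPn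

/-- **S₃-locus (K-side), with a witness filter `Φ`**: PRINT, K1 and the filtered K2(Φ)/K3(Φ), rank-`0` `BSD₂` of non-CM curves ⟹ `BSD₂(W)` for
`W` non-CM with `ρ̄_{W,2}` ONTO (δ ∪ γ₂a/b/c/d) and analytic rank `1` (ANY Tamagawa parity).  g1's `bsdp_two_delta` VERBATIM except that the
habitat hypothesis is `hρ2 : W.HasSurjectiveModNGaloisRep 2` (which is all the body ever used) and the witness primes carry `Φ`: Kolyvagin-admissible
Hoffstein–Luo door (`exists_kolyvaginDoorField_of_analyticRank_eq_one`, image-free), ANY datum, `β`, `ι`, the proved conductor-`1` datum, `y_K`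
non-torsion by Gross–Zagier, `M₀` by finite generation, `σ ≤ M₀` from K1 at `n = 1`, the twin = minimal model of `E^{(d_K)}`, the shifted exact
descent `bsdp_two_of_card_sha_baseChange_eq_shifted_rankOne` (mod-`2` image only).  PROVED for every `Φ`.
[cite: GrossLMS1991, §2 Conj. (2.2), §§3–4] [cite: McCallumLMS1991, §5] [cite: Jetchev2008, p. 3 Hyp., (1.3)] -/
theorem bsdp_two_S3locusWith (Φ : WeierstrassCurve ℚ → ℕ → Prop)
    (hpub : S_pub) (hHL : S_pubHL) (hMilneC : Milne1972.bsdQuotient_baseChange_quadratic_anyModel)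
    (hK1 : SigmaAccumulationModTwoAtTwo) (hK2 : StringentPrimitivityModTwoWith Φ) (hK3 : ShiftedKolyvaginStructureModTwoWith Φ)
    (hZ : S_rankZeroTwin)
    (W : WeierstrassCurve ℚ) [W.IsElliptic] [W.IsGloballyMinimal] (hCM : ¬ W.HasCM)
    (hρ2 : W.HasSurjectiveModNGaloisRep 2) (hr : W.analyticRank = 1) : BSDp W 2 := by
  haveI : Fact (Nat.Prime 2) := ⟨Nat.prime_two⟩
  haveI hN : NeZero (W.conductorNorm ℤ) := ⟨(W.conductorNorm_pos_holds).ne'⟩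
  have hnf : exists_isNewformOf := hHL.1
  have hmod : hasEntireLFunction_rat := hpub.2.2
  have hGZK : rank_eq_analyticRank_of_analyticRank_le_one := hpub.2.1
  -- the Kolyvagin-admissible door
  obtain ⟨K, _iF, _iN, hK, hodd, h3, hH, hsq1, hsq2, -, hLt, -⟩ :=
    exists_kolyvaginDoorField_of_analyticRank_eq_one hnf hHL.2 W hr
  -- ANY datum, the orientation, the embedding, the conductor-`1` datum
  obtain ⟨Dt⟩ := (nonempty_modularParametrizationData_iff_exists_isNewformOf_unconditional.mpr hnf) W
  obtain ⟨β, hβ⟩ : ∃ β : ℤ, (4 * (W.conductorNorm ℤ : ℕ) : ℤ) ∣ β ^ 2 - NumberField.discr K :=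
    Literature.NumberTheory.QuadraticFields.Quadratic.exists_dvd_sq_sub_discr_of_ncard_primesOver hK.1 (NeZero.ne _) hH
  obtain ⟨ι⟩ : Nonempty (K →+* ℂ) := inferInstance
  obtain ⟨d₁⟩ := exists_kolyvaginHeegnerData_one
    (phi_heegnerTau_mem_singularModuliField_holds (W.conductorNorm ℤ) W K) hK Dt β ι hβ
  -- `y_K` has infinite order: `L'(W/K, 1) = L'(W, 1) · L(W^{(d_K)}, 1) ≠ 0` and Gross–Zagier
  haveI hEK : (W.baseChange K).IsElliptic := isElliptic_baseChange' W K
  have hL0 : W.entireLFunction 1 = 0 := entireLFunction_one_eq_zero_of_analyticRank_eq_one hr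
  obtain ⟨-, hderiv⟩ := leadingLCoeff_eq_deriv_of_analyticRank_eq_one hr
  have hLK : LDerivEK W K ≠ 0 := by
    rw [lDerivEK_eq_deriv_mul W K hmod hL0]; exact mul_ne_zero hderiv hLt
  obtain ⟨hGZ, -, -⟩ := hpub.1 (W.conductorNorm ℤ) W K
  obtain ⟨P₀, Hd, hP₀, hP₀K⟩ := exists_heegnerPoint_map_eq_derivedPoint_one hK hH d₁
  have hP₀inf : ¬ IsOfFinAddOrder P₀ :=
    (lDerivEK_ne_zero_iff_not_isOfFinAddOrder W (W.conductorNorm ℤ) K hGZ hK hH ⟨Dt, Hd, ι, hP₀⟩).mp hLK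
  have hy : ¬ IsOfFinAddOrder d₁.derivedPoint := by
    intro hfin
    apply hP₀inf
    rw [← hP₀K] at hfin
    exact (WeierstrassCurve.Affine.Point.map_injective (W' := W) _).isOfFinAddOrder_iff.mp hfin
  -- `M₀ = ord₂(y_K)` in `E(K[1])` (a number field: finite generation)
  obtain ⟨M₀, hdiv, hndiv⟩ : ∃ M₀ : ℕ,
      (∃ Q : (W.baseChange (ringClassField K ι 1)).toAffine.Point, ((2 ^ M₀ : ℕ) : ℤ) • Q = d₁.derivedPoint) ∧
      ¬ ∃ Q : (W.baseChange (ringClassField K ι 1)).toAffine.Point, ((2 ^ (M₀ + 1) : ℕ) : ℤ) • Q = d₁.derivedPoint := by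
    haveI : NumberField (ringClassField K ι 1) := numberField_ringClassField hK ι one_ne_zero
    haveI : (W.baseChange (ringClassField K ι 1)).IsElliptic := by rw [baseChange]; infer_instance
    haveI : Module.Finite ℤ (W.baseChange (ringClassField K ι 1)).toAffine.Point := by
      convert (W.baseChange (ringClassField K ι 1)).module_finite_point_holds
    exact exists_pow_smul_eq_and_not_of_not_isOfFinAddOrder Nat.prime_two hy
  -- the three stubs: Σ-accumulation, filtered stringent primitivity, filtered shifted structure theorem
  have hacc := hK1 W hCM hρ2 hr K hK hodd h3 hH hsq1 hsq2 Dt β ι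
  obtain ⟨n, d, hn, hKoly, hlev, hPn⟩ := hK2 W hCM hρ2 hr K hK hodd h3 hH hsq1 hsq2 Dt β ι d₁ hy
  have hsha : Nat.card (AddCommGroup.primaryComponent (W.baseChange K).sha 2) = 2 ^ (2 * (M₀ - sigmaShift W Dt)) :=
    hK3 W hCM hρ2 K hK hodd h3 hH hsq1 hsq2 Dt β ι d₁ hy M₀ hdiv hndiv hacc n d hn hKoly hlev hPn
  -- `σ ≤ M₀`: accumulation at `n = 1` (`M(1) = ∞`) against the exactness of `M₀`
  have hσ : sigmaShift W Dt ≤ M₀ := by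
    by_contra hlt
    push Not at hlt
    exact hndiv (hacc 1 d₁ (M₀ + 1) squarefree_one (by simp) (by simp) (by omega))
  -- the twin: a globally minimal model, non-CM, of analytic rank `0`; its `BSD₂` from the rank-`0` statement
  have hD0 : (NumberField.discr K : ℚ) ≠ 0 := by exact_mod_cast NumberField.discr_ne_zero K
  haveI hEt : (W.quadraticTwist (NumberField.discr K : ℚ)).IsElliptic := W.isElliptic_quadraticTwist hD0
  obtain ⟨Cd, hCd⟩ := hasGlobalMinimalModel_rat_holds (W.quadraticTwist (NumberField.discr K : ℚ))
  haveI : (Cd • W.quadraticTwist (NumberField.discr K : ℚ)).IsGloballyMinimal := hCd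
  have hCMd : ¬ (Cd • W.quadraticTwist (NumberField.discr K : ℚ)).HasCM :=
    Summit.BirchSwinnertonDyer.BirchSwinnertonDyer.Theorems.RamifiedPairUpperBound.not_hasCM_of_smul_quadraticTwist_eq hD0 rfl hCM
  have hrt : (W.quadraticTwist (NumberField.discr K : ℚ)).analyticRank = 0 :=
    ((W.quadraticTwist _).analyticRank_eq_zero_iff_holds (hmod _)).mpr hLt
  have hrd : (Cd • W.quadraticTwist (NumberField.discr K : ℚ)).analyticRank = 0 := by
    rw [analyticRank_smul, hrt]
  have hBd : BSDp (Cd • W.quadraticTwist (NumberField.discr K : ℚ)) 2 := hZ _ hCMd hrd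
  exact bsdp_two_of_card_sha_baseChange_eq_shifted_rankOne W K Dt β ι d₁ (Cd • W.quadraticTwist (NumberField.discr K : ℚ))
    hGZ hGZK hmod hMilneC hρ2 hr hK hodd h3 hH hy hdiv hndiv hσ hsha ⟨Cd, rfl⟩ hBd

/-- **S₃-locus (K-side), registered shape** (`Φ = ⊤`): PRINT, K1, K2, K3 on the mod-`2`-surjective habitat, rank-`0` `BSD₂` ⟹ `BSD₂(W)` for `W` non-CM
with `ρ̄_{W,2}` onto of analytic rank `1`.  (g1's `bsdp_two_delta` is the restriction to δ.) -/
theorem bsdp_two_S3locus (hpub : S_pub) (hHL : S_pubHL) (hMilneC : Milne1972.bsdQuotient_baseChange_quadratic_anyModel)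
    (hK1 : SigmaAccumulationModTwoAtTwo) (hK2 : StringentPrimitivityModTwoAtTwo) (hK3 : ShiftedKolyvaginStructureModTwoAtTwo)
    (hZ : S_rankZeroTwin)
    (W : WeierstrassCurve ℚ) [W.IsElliptic] [W.IsGloballyMinimal] (hCM : ¬ W.HasCM)
    (hρ2 : W.HasSurjectiveModNGaloisRep 2) (hr : W.analyticRank = 1) : BSDp W 2 :=
  bsdp_two_S3locusWith (fun _ _ => True) hpub hHL hMilneC hK1 (stringentWith_top_of_modTwo hK2)
    (structureWith_of_modTwo _ hK3) hZ W hCM hρ2 hr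

/-- (APPEND, lead g8) **The two γ₁ faces recombine** to the per-curve CT law on γ₁ (`Nat.even_or_odd ∏c`; on the odd face `2·v₂(odd) = 0`). -/
theorem gamma1LawCT_of_faces (hO : Gamma1OddCDoorIndexLawAtTwo) (hE : Gamma1EvenCDoorIndexLawAtTwo) :
    Gamma1DoorIndexLawCTAtTwo := by
  intro W _ _ _ hCM hT2 hΔ hr K _ _ hK hadm hHN hLt Dt H ι P hP Wd _ _ Cd hWd
  rcases Nat.even_or_odd W.tamagawaProduct with hev | hodd
  · exact hE W hCM hT2 hΔ hev hr K hK hadm hHN hLt Dt H ι P hP Wd Cd hWd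
  · obtain ⟨m, hm, hlaw⟩ := hO W hCM hT2 hΔ hodd hr K hK hadm hHN hLt Dt H ι P hP Wd Cd hWd
    refine ⟨m, hm, ?_⟩
    rw [padicValNat.eq_zero_of_not_dvd (fun h => (Nat.not_even_iff_odd.mpr hodd) (even_iff_two_dvd.mpr h)), mul_zero, add_zero]
    exact hlaw

end Summit.BirchSwinnertonDyer.BirchSwinnertonDyer.Theorems.OffBigImageOddLocalAtTwo

end
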